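import Literature.AlgebraicGeometry.Resolution.BlowupAxialPoint
import Literature.AlgebraicGeometry.Resolution.PrimeDivisorIdeals
import Literature.AlgebraicGeometry.Resolution.StalkIdealGenerization
import Literature.AlgebraicGeometry.Resolution.SubschemeRegularStalks
import Literature.AlgebraicGeometry.Resolution.OrderSemicontinuityPointwise
import HarnessLib

/-!
# Prime divisors through a blowing up: regular centres with principal stalks propagate

Topic: `Literature/AlgebraicGeometry/Resolution`. Let `π : X' → X` be a blowing up (universal
property) of an integral locally Noetherian scheme along the reduced ideal `𝓘_D` of a closed
subset `D`, and suppose that at every point `x ∈ D` the stalk `(𝓘_D)_x` is generated by a part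
`c` of a regular system of parameters of the (regular) local ring `𝒪_{X,x}` — e.g. `D` a closed
point of a regular scheme (`c` a full regular system of parameters), or `D` a regular prime divisor
with principal stalks. Let `ζ' ∈ X'` be a point of codimension one (`dim 𝒪_{X',ζ'} = 1`) over
`D` — a generic point of the exceptional divisor. PROVED here:

* `IsBlowup.exists_rsop_stalkIdeal_primeDivisorIdeal` — **at every point `x'` of `E' = cl{ζ'}`,
  the local ring `𝒪_{X',x'}` is regular and `(𝓘_{E'})_{x'} = (g')` for an element `g'` of a regular
  system of parameters** (the local equation of the exceptional divisor: in the chart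
  `B = 𝒪_{X,x}[𝓘/c_j]`, `𝓘_D B = (c_j)` and `(c_j, …)` is part of a regular system of parameters of
  `B_𝔴 = 𝒪_{X',x'}`, de Jong 2.4 / Stacks 0BIQ via `isRsopPart_chartFamily_reesChart`; the prime
  `𝔭_{ζ'} ⊇ (c_j)` of height one equals `(c_j)`). So the hypothesis PROPAGATES from `D ⊆ X` to
  `E' ⊆ X'` (`IsBlowup.forall_exists_rsop_stalkIdeal_primeDivisorIdeal`), along any tower of such
  blowing ups.
* `IsBlowup.isRegular_subscheme_primeDivisorIdeal` — hence the reduced closed subscheme `E'` is a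
  REGULAR scheme, and (`IsBlowup.forall_le_idealOrder_iff_of_specializes`) an ideal sheaf has
  order `≥ b` at every point of `E'` iff it has order `≥ b` at `ζ'` (orders do not drop under
  specialisation at regular points).

These are the centre conditions (regular, irreducible, inside `Sing`) for blowing up the
exceptional prime divisor again — the hypersurface ("type (II)") steps of a test sequence.

## Sources

* A. J. de Jong, Publ. Math. IHÉS 83 (1996), 2.4. [DeJong1996]
* The Stacks Project, Tags 0804, 0BIQ, 01J7, 02IZ. [StacksProject]
* V. Cossart, O. Piltant, J. Algebra 320 (2008), proof of Prop. 4.2 (the divisors `E_j`).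
  [CossartPiltant2008]
-/

noncomputable section

open CategoryTheory AlgebraicGeometry TopologicalSpace IsLocalRing

namespace Literature.AlgebraicGeometry.Resolution

universe u

open Scheme.IdealSheafData

variable {X' X : Scheme.{u}} {π : X' ⟶ X}

/-- A one-element family as `Fin.cons`. [folklore] -/
private theorem fin_one_eq (R : Type u) (g : R) (f : Fin 1 → R) (h : f 0 = g) :
    f = ![g] := by
  funext i
  fin_cases i
  simpa using h

/-- The range of a one-element family. [folklore] -/
private theorem range_vecSingle {R : Type u} (g : R) : Set.range ![g] = {g} := by
  ext a
  simp [eq_comm]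

/-- **Principal regular stalks propagate to the exceptional prime divisor.** Let `π : X' → X` be
a blowing up of the integral locally Noetherian scheme `X` along `𝓘_D`, `D` closed, such that for
every `x ∈ D` the stalk `(𝓘_D)_x` is generated by a part of a regular system of parameters of
`𝒪_{X,x}`; let `ζ' ∈ X'` lie over `D` with `dim 𝒪_{X',ζ'} = 1`. Then at every specialisation `x'`
of `ζ'`, `𝒪_{X',x'}` is regular and the stalk of `𝓘_{cl{ζ'}}` is `(g')` with `g'` a regular
parameter (`IsRsopPart ![g']`). [cite: DeJong1996, 2.4] [cite: StacksProject, Tag 0BIQ] -/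
theorem IsBlowup.exists_rsop_stalkIdeal_primeDivisorIdeal [IsIntegral X] [IsLocallyNoetherian X]
    [IsLocallyNoetherian X'] {D : Closeds X} (hπ : IsBlowup π (vanishingIdeal D))
    (hD : ∀ x ∈ D, ∃ (k : ℕ) (c : Fin k → X.presheaf.stalk x),
      IsRsopPart c ∧ stalkIdeal (vanishingIdeal D) x = Ideal.span (Set.range c))
    {ζ' : X'} (hζ : π ζ' ∈ D) (hdim : ringKrullDim (X'.presheaf.stalk ζ') = 1)
    {x' : X'} (hsp : ζ' ⤳ x') :
    ∃ g' : X'.presheaf.stalk x', IsRsopPart ![g'] ∧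
      stalkIdeal (primeDivisorIdeal ζ') x' = Ideal.span {g'} := by
  classical
  -- `π x' ∈ D` and the chart data there
  have hx : π x' ∈ D := by
    have h := (hsp.map π.continuous).mem_closed D.isClosed hζ
    exact h
  obtain ⟨k, c, hc, hcJ⟩ := hD (π x') hx
  haveI : IsRegularLocalRing (X.presheaf.stalk (π x')) := hc.isRegularLocalRing
  obtain ⟨j, 𝔴, χ, hχ, hloc, h𝔴⟩ := hπ.exists_reesChart_stalk x' c hcJ.symm
  letI := χ.toAlgebra
  haveI : IsLocalization.AtPrime (X'.presheaf.stalk x') 𝔴.asIdeal := hloc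
  -- extend `c` to a full regular system of parameters `(c, w)`
  obtain ⟨e, xx, hd, hxx, hxxc⟩ := hc.exists_rsop
  let w : Fin e → X.presheaf.stalk (π x') := fun i => xx (Fin.natAdd k i)
  have hcw : Fin.append c w = xx := by
    have : c = fun i => xx (Fin.castAdd e i) := funext fun i => (hxxc i).symm
    rw [this]
    exact Fin.append_castAdd_natAdd
  have hz : Ideal.span (Set.range (Fin.append c w)) = maximalIdeal (X.presheaf.stalk (π x')) := by
    rw [hcw]; exact hxx
  -- the chart family `(c_j, w)` is part of a regular system of parameters of `𝒪_{X',x'}`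
  have hfam := isRsopPart_chartFamily_reesChart c j w hz hd 𝔴.asIdeal h𝔴 (X'.presheaf.stalk x')
    (a := 0) (fun i => i.elim0) (fun i => i.elim0) (fun i => i.elim0)
  set g' : X'.presheaf.stalk x' := (π.stalkMap x').hom (c j) with hg'def
  have hg'χ : χ (chartBase c j (c j)) = g' := hχ (c j)
  have hg : IsRsopPart ![g'] := by
    have h := hfam.comp (fun _ : Fin 1 => (0 : Fin (0 + e + 1))) (fun a b _ => Subsingleton.elim a b)
    have heq : chartFamily c j w (X'.presheaf.stalk x') (chartBase c j) (chartGen c j)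
        (fun i : Fin 0 => i.elim0) ∘ (fun _ : Fin 1 => (0 : Fin (0 + e + 1))) = ![g'] := by
      refine fin_one_eq _ g' _ ?_
      simp only [Function.comp_apply, chartFamily, Fin.cons_zero]
      exact hg'χ
    rwa [heq] at h
  -- the stalk of the exceptional ideal is `(g')`
  have hE : stalkIdeal ((vanishingIdeal D).comap π) x' = Ideal.span {g'} := by
    rw [stalkIdeal_comap_eq_map_stalkMap π _ x', hcJ, hg'def]
    refine Ideal.map_span_range_eq_span_singleton _ c j (fun l => χ (chartGen c j l)) fun l => ?_
    rw [← hχ (c l), ← hχ (c j), ← map_mul]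
    exact congrArg χ (reesChartBase_apply_eq_mul_chartGen c j l)
  -- the prime of `ζ'` at `x'` contains it and has height one, hence equals it
  let 𝔭 : Ideal (X'.presheaf.stalk x') := primeOfSpecializes hsp
  have hle : Ideal.span {g'} ≤ 𝔭 := by
    rw [← hE]
    refine (mem_support_iff_stalkIdeal_le_primeOfSpecializes hsp _).mp ?_
    rw [support_comap]
    change π ζ' ∈ ((vanishingIdeal D).support : Set X)
    rw [coe_support_vanishingIdeal]
    exact hζ
  haveI hgprime : (Ideal.span {g'} : Ideal (X'.presheaf.stalk x')).IsPrime := by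
    have := hg.isPrime_span_range
    rwa [range_vecSingle] at this
  haveI : IsRegularLocalRing (X'.presheaf.stalk x') := hg.isRegularLocalRing
  haveI : IsDomain (X'.presheaf.stalk x') := isDomain_of_isRegularLocalRing _
  have h𝔭ht : 𝔭.height = 1 := by
    letI := (X'.presheaf.stalkSpecializes hsp).hom.toAlgebra
    haveI : IsLocalization.AtPrime (X'.presheaf.stalk ζ') 𝔭 :=
      Literature.AlgebraicGeometry.Motives.isLocalizationAtPrime_stalkSpecializes hsp
    have h := IsLocalization.AtPrime.ringKrullDim_eq_height 𝔭 (X'.presheaf.stalk ζ')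
    rw [hdim] at h
    exact_mod_cast h.symm
  have heq : Ideal.span {g'} = 𝔭 := by
    by_contra hne
    have hlt : Ideal.span {g'} < 𝔭 := lt_of_le_of_ne hle hne
    have h1 := Ideal.height_add_one_le_of_lt_of_isPrime hlt
    rw [h𝔭ht] at h1
    have h0 : (Ideal.span {g'} : Ideal (X'.presheaf.stalk x')).height = 0 := by
      have : (Ideal.span {g'} : Ideal (X'.presheaf.stalk x')).height ≠ ⊤ :=
        Ideal.height_ne_top_of_isPrime
      obtain ⟨m, hm⟩ := ENat.ne_top_iff_exists.mp this
      rw [← hm] at h1 ⊢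
      have : (m + 1 : ℕ) ≤ 1 := by exact_mod_cast h1
      have : m = 0 := by omega
      simp [this]
    rw [Ideal.height_eq_zero_iff_eq_bot, Ideal.span_singleton_eq_bot] at h0
    exact hg.ne_zero 0 h0
  exact ⟨g', hg, (stalkIdeal_primeDivisorIdeal hsp).trans heq.symm⟩

/-- **The hypothesis propagates**: under the same assumptions, every point of `E' = cl{ζ'}` has the
stalk of `𝓘_{E'}` generated by a part (one element) of a regular system of parameters.
[cite: DeJong1996, 2.4] -/
theorem IsBlowup.forall_exists_rsop_stalkIdeal_primeDivisorIdeal [IsIntegral X]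
    [IsLocallyNoetherian X] [IsLocallyNoetherian X'] {D : Closeds X}
    (hπ : IsBlowup π (vanishingIdeal D))
    (hD : ∀ x ∈ D, ∃ (k : ℕ) (c : Fin k → X.presheaf.stalk x),
      IsRsopPart c ∧ stalkIdeal (vanishingIdeal D) x = Ideal.span (Set.range c))
    {ζ' : X'} (hζ : π ζ' ∈ D) (hdim : ringKrullDim (X'.presheaf.stalk ζ') = 1) :
    ∀ x' ∈ (⟨closure {ζ'}, isClosed_closure⟩ : Closeds X'),
      ∃ (k : ℕ) (c : Fin k → X'.presheaf.stalk x'), IsRsopPart c ∧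
        stalkIdeal (vanishingIdeal ⟨closure {ζ'}, isClosed_closure⟩) x' =
          Ideal.span (Set.range c) := by
  intro x' hx'
  have hsp : ζ' ⤳ x' := specializes_iff_mem_closure.mpr hx'
  obtain ⟨g', hg, hst⟩ := hπ.exists_rsop_stalkIdeal_primeDivisorIdeal hD hζ hdim hsp
  exact ⟨1, ![g'], hg, by rw [range_vecSingle]; exact hst⟩

/-- **The exceptional prime divisor is a regular scheme**: under the same assumptions, the reduced
closed subscheme `cl{ζ'}` of `X'` is regular (its local rings are `𝒪_{X',x'}/(g')` with `g'` a
regular parameter, Matsumura 14.2). [cite: DeJong1996, 2.4] [cite: Matsumura1987, Thm. 14.2] -/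
theorem IsBlowup.isRegular_subscheme_primeDivisorIdeal [IsIntegral X] [IsLocallyNoetherian X]
    [IsLocallyNoetherian X'] {D : Closeds X} (hπ : IsBlowup π (vanishingIdeal D))
    (hD : ∀ x ∈ D, ∃ (k : ℕ) (c : Fin k → X.presheaf.stalk x),
      IsRsopPart c ∧ stalkIdeal (vanishingIdeal D) x = Ideal.span (Set.range c))
    {ζ' : X'} (hζ : π ζ' ∈ D) (hdim : ringKrullDim (X'.presheaf.stalk ζ') = 1) :
    Scheme.IsRegular (primeDivisorIdeal ζ').subscheme := by
  refine Scheme.isRegular_subscheme_of_forall _ fun x' hx' => ?_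
  rw [mem_support_primeDivisorIdeal_iff] at hx'
  obtain ⟨g', hg, hst⟩ := hπ.exists_rsop_stalkIdeal_primeDivisorIdeal hD hζ hdim hx'
  rw [hst, ← range_vecSingle]
  exact hg.isRegularLocalRing_quotient

/-- **Orders along the exceptional prime divisor are read at its generic point**: under the same
assumptions, an ideal sheaf `I` on `X'` has `ord_{x'} I ≥ b` at every point `x'` of `cl{ζ'}` iff
`ord_{ζ'} I ≥ b` (all these points are regular, and orders do not drop under specialisation at a
regular point, Cossart–Piltant Prop. 4.2). [cite: CossartPiltant2008, proof of Prop. 4.2] -/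
theorem IsBlowup.forall_le_idealOrder_iff_of_specializes [IsIntegral X] [IsLocallyNoetherian X]
    [IsLocallyNoetherian X'] {D : Closeds X} (hπ : IsBlowup π (vanishingIdeal D))
    (hD : ∀ x ∈ D, ∃ (k : ℕ) (c : Fin k → X.presheaf.stalk x),
      IsRsopPart c ∧ stalkIdeal (vanishingIdeal D) x = Ideal.span (Set.range c))
    {ζ' : X'} (hζ : π ζ' ∈ D) (hdim : ringKrullDim (X'.presheaf.stalk ζ') = 1)
    (I : X'.IdealSheafData) (b : ℕ) :
    (∀ x' ∈ closure ({ζ'} : Set X'), (b : ℕ∞) ≤ idealOrder I x') ↔ (b : ℕ∞) ≤ idealOrder I ζ' := by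
  constructor
  · intro h
    exact h ζ' (subset_closure rfl)
  · intro h x' hx'
    have hsp : ζ' ⤳ x' := specializes_iff_mem_closure.mpr hx'
    obtain ⟨g', hg, -⟩ := hπ.exists_rsop_stalkIdeal_primeDivisorIdeal hD hζ hdim hsp
    haveI : IsRegularLocalRing (X'.presheaf.stalk x') := hg.isRegularLocalRing
    exact h.trans (idealOrder_le_of_specializes hsp I)

/-! ## The starting hypothesis: a closed point, or any point with a full regular system of parameters -/

/-- **The hypothesis at the start of a tower**: for a closed point `P` with regular local ring and
a regular system of parameters `c` generating `𝔪_P`, the reduced ideal of `cl{P} = {P}` has stalk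
`(c)` at its only point (Stacks 01J7: `𝓘_{cl{P},P} = 𝔪_P`). [cite: StacksProject, Tag 01J7] -/
theorem forall_exists_rsop_stalkIdeal_vanishingIdeal_closure_point {P : X} {n : ℕ}
    (c : Fin n → X.presheaf.stalk P) (hc : Ideal.span (Set.range c) = maximalIdeal _)
    (hreg : IsRsopPart c) (hP : IsClosed ({P} : Set X)) :
    ∀ x ∈ (⟨closure {P}, isClosed_closure⟩ : Closeds X),
      ∃ (k : ℕ) (c' : Fin k → X.presheaf.stalk x), IsRsopPart c' ∧
        stalkIdeal (vanishingIdeal ⟨closure {P}, isClosed_closure⟩) x = Ideal.span (Set.range c') := by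
  intro x hx
  change x ∈ closure {P} at hx
  rw [hP.closure_eq, Set.mem_singleton_iff] at hx
  subst hx
  refine ⟨n, c, hreg, ?_⟩
  rw [hc]
  exact stalkIdeal_vanishingIdeal_closure_self x

end Literature.AlgebraicGeometry.Resolution

end
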